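import Summits.BirchSwinnertonDyer.BirchSwinnertonDyer.Theorems.ByReductionTypeAtTwoMultTowerSplitExactTransfer
import Literature.NumberTheory.EllipticCurves.CyclotomicZpExtension
import Mathlib.RingTheory.ZMod.UnitsCyclic
import HarnessLib

/-!
# Route `ByReductionTypeAtTwo`, crux `MultUpperHalfAtTwo` (item stmt-BirchSwinnertonDyer-19922), TOWER road, SPLIT rows:
# the EXACT order of the local tower kernel at a split multiplicative prime, part 4 (ODD `p`) — `p`-adic units:
# `1 + p^{m+1}ℤ_p ⊆ (ℤ_pˣ)^{p^m}` and the subgroup `T_m = ⟨p⟩·{w : w^{p−1} ≡ 1 (mod p^{m+1})}` of `ℚ_pˣ`, index `≤ p^m`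

HONEST FRAMING (cell `bsd-2adic`, run/shared/lean/pub/bsd-2adic/, seat `bsd-2adic-tower-1` GEN 27, HUMAN RULINGS
D-0036 / D-0054 / D-0074): TOOL theorems only (no definition, no named fact, no `sorry`); closes nothing by itself;
nothing booked; BSD is not proved by any of this. First ODD-`p` module towards the `∀ p` named fact
`hSP = Greenberg1999.sec3_natCard_localTowerKerPrimary_splitMultiplicative_rat` (Greenberg, LNM 1716, §3 pp. 92–93), whose
`p = 2` clause is `MultTowerSplitExact.sec3_natCard_localTowerKerPrimary_splitMultiplicative_two` (part 3). The odd-`p` road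
is the same as at `p = 2` (parts 1–3 + seat bsd-2adic-mult GEN 13's count), with the norm group of the `m`-th local layer
`F_m` of the cyclotomic `ℤ_p`-tower `N(F_mˣ) = ⟨p⟩ · μ_{p−1} · (1 + p^{m+1}ℤ_p) = {x : (unit part of x)^{p−1} ≡ 1 (mod p^{m+1})}`
in place of GEN 9's BRICK 14 `⟨2⟩·±(1 + 2^{m+2}ℤ₂)`. This file is the `p`-adic-units half of that identification (the odd-`p`
analogue of GEN 9's BRICK 12 `…MultTowerNS2TwoAdicUnits.lean`):

* `exists_units_pow_prime_pow_eq_of_toZModPow_eq_one` — **`1 + p^{m+1}ℤ_p ⊆ (ℤ_pˣ)^{p^m}`** (odd `p`): `u ≡ 1 (mod p^{m+1})`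
  is `(1+p)^x` with `‖x‖ ≤ p^{−m}` (the tree's `PadicOneUnits.oneAddPow` / `exists_oneAddPow_eq` / `norm_oneAddPow_sub_one`,
  Serre *Cours d'arithmétique* II §3), so `u = ((1+p)^y)^{p^m}`;
* `exists_eq_prime_zpow_mul_units`, `prime_zpow_mul_units_inj` — `ℚ_pˣ = p^ℤ × ℤ_pˣ`;
* `exists_subgroup_oddLayerNorm` — the subgroup `T_m = {p^j·w : w ∈ ℤ_pˣ, w^{p−1} ≡ 1 (mod p^{m+1})}` of `ℚ_pˣ` exists and
  has index `≤ p^m` (kernel of `ℚ_pˣ → ℤ_pˣ → (ℤ/p^{m+1})ˣ —(·)^{p−1}→ (ℤ/p^{m+1})ˣ`; the image has at most `p^m` elements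
  because `(ℤ/p^{m+1})ˣ` is cyclic of order `(p−1)p^m` — Mathlib `ZMod.isCyclic_units_of_prime_pow` — so the `(p−1)`-th
  powers are killed by `p^m` and `#{a : a^{p^m} = 1} ≤ p^m`, `IsCyclic.card_pow_eq_one_le`).

References: J.-P. Serre, *A Course in Arithmetic*, Ch. II §3.2; J. Neukirch, *ANT* II (5.7), V (1.1); R. Greenberg, LNM 1716
§3 pp. 92–93; cell memo NOTE-HNS2-KERNEL-GEN27.md (Stage D plan).
-/

set_option autoImplicit false
-- the Theorems namespace of this sub repeats the summit name by design (D-0017 nested layout: Summit.<S>.<Sub>)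
set_option linter.dupNamespace false

noncomputable section

open scoped Classical

namespace Summit.BirchSwinnertonDyer.BirchSwinnertonDyer.Theorems.MultTowerSplitExact

open PadicInt Literature.NumberTheory.EllipticCurves.PadicOneUnits

variable {p : ℕ} [hp : Fact p.Prime]

/-! ### `1 + p^{m+1}ℤ_p ⊆ (ℤ_pˣ)^{p^m}` for odd `p` -/

/-- **`1 + p^{m+1}ℤ_p ⊆ (ℤ_pˣ)^{p^m}` (odd `p`).** If `u ≡ 1 (mod p^{m+1})` then `u = c^{p^m}` for a unit `c`: `u = (1+p)^x`
with `‖x‖·‖p‖ = ‖u − 1‖ ≤ p^{−(m+1)}`, so `x = p^m y` and `u = ((1+p)^y)^{p^m}`. [cite: Serre1973, Ch. II §3.2 Prop. 8] -/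
theorem exists_units_pow_prime_pow_eq_of_toZModPow_eq_one (hp2 : p ≠ 2) (m : ℕ) {u : ℤ_[p]}
    (hu : toZModPow (m + 1) u = 1) : ∃ c : ℤ_[p]ˣ, ((c : ℤ_[p])) ^ p ^ m = u := by
  have hp3 : 3 ≤ p := by
    have h2 := hp.out.two_le
    omega
  have he : 0 + 3 ≤ p * (0 + 1) := by omega
  -- `‖u − 1‖ ≤ p^{−(m+1)}`
  have hn : ‖u - 1‖ ≤ (p : ℝ) ^ (-(((m + 1 : ℕ) : ℤ))) := by
    have h : u - 1 ∈ Ideal.span {(p : ℤ_[p]) ^ (m + 1)} := by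
      rw [← ker_toZModPow, RingHom.mem_ker, map_sub, hu, map_one, sub_self]
    exact (norm_le_pow_iff_mem_span_pow _ _).mpr h
  have hp0 : (0 : ℝ) < p := by exact_mod_cast hp.out.pos
  have hp1 : (1 : ℝ) ≤ p := by exact_mod_cast hp.out.one_lt.le
  have hu1 : ‖u - 1‖ ≤ ‖(p : ℤ_[p]) ^ (0 + 1)‖ := by
    rw [zero_add, pow_one, PadicInt.norm_p, ← zpow_neg_one]
    exact hn.trans (zpow_le_zpow_right₀ hp1 (by omega))
  obtain ⟨x, hx⟩ := exists_oneAddPow_eq 0 he hu1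
  -- `‖x‖ ≤ p^{−m}`
  have hxn : ‖x‖ * ‖(p : ℤ_[p]) ^ (0 + 1)‖ = ‖u - 1‖ := by rw [← norm_oneAddPow_sub_one 0 he x, hx]
  rw [zero_add, pow_one, PadicInt.norm_p] at hxn
  have hxle : ‖x‖ ≤ (p : ℝ) ^ (-(m : ℤ)) := by
    have h1 : ‖x‖ = ‖u - 1‖ * p := by
      field_simp at hxn
      linarith [hxn]
    rw [h1]
    calc ‖u - 1‖ * p ≤ (p : ℝ) ^ (-(((m + 1 : ℕ) : ℤ))) * p := by gcongr
      _ = (p : ℝ) ^ (-(m : ℤ)) := by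
        rw [show (-(((m + 1 : ℕ) : ℤ))) = -(m : ℤ) + (-1) by push_cast; ring, zpow_add₀ hp0.ne', zpow_neg_one]
        field_simp
  have hxm : x ∈ Ideal.span {(p : ℤ_[p]) ^ m} := (norm_le_pow_iff_mem_span_pow x m).mp hxle
  obtain ⟨y, hy⟩ := Ideal.mem_span_singleton'.mp hxm
  refine ⟨(PadicInt.isUnit_iff.mpr (norm_oneAddPow 0 y)).unit, ?_⟩
  rw [IsUnit.unit_spec, ← hx, ← hy, mul_comm y, show (p : ℤ_[p]) ^ m * y = (p ^ m : ℕ) • y by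
    rw [nsmul_eq_mul, Nat.cast_pow], AddChar.map_nsmul_eq_pow]

/-! ### `ℚ_pˣ = p^ℤ · ℤ_pˣ` -/

/-- **`ℚ_pˣ = p^ℤ · ℤ_pˣ`**: every non-zero `x ∈ ℚ_p` is `p^j · w` with `j ∈ ℤ`, `w ∈ ℤ_pˣ`. [folklore] -/
theorem exists_eq_prime_zpow_mul_units (x : ℚ_[p]) (hx : x ≠ 0) :
    ∃ (j : ℤ) (w : ℤ_[p]ˣ), x = (p : ℚ_[p]) ^ j * ((w : ℤ_[p]) : ℚ_[p]) := by
  have hp0 : (p : ℚ_[p]) ≠ 0 := by exact_mod_cast hp.out.ne_zero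
  set j : ℤ := x.valuation with hj
  have hw : ‖x * (p : ℚ_[p]) ^ (-j)‖ = 1 := by
    rw [norm_mul, Padic.norm_p_zpow, neg_neg, Padic.norm_eq_zpow_neg_valuation hx, ← hj,
      ← zpow_add₀ (by exact_mod_cast hp.out.ne_zero : ((p : ℝ)) ≠ 0)]
    simp
  refine ⟨j, PadicInt.mkUnits hw, ?_⟩
  rw [PadicInt.mkUnits_eq, mul_comm, mul_assoc, ← zpow_add₀ hp0, neg_add_cancel, zpow_zero, mul_one]

/-- Uniqueness of `x = p^j · w`: the exponent and the unit are determined. [folklore] -/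
theorem prime_zpow_mul_units_inj {j j' : ℤ} {w w' : ℤ_[p]ˣ}
    (h : (p : ℚ_[p]) ^ j * ((w : ℤ_[p]) : ℚ_[p]) = (p : ℚ_[p]) ^ j' * ((w' : ℤ_[p]) : ℚ_[p])) :
    j = j' ∧ w = w' := by
  have hp0 : (p : ℚ_[p]) ≠ 0 := by exact_mod_cast hp.out.ne_zero
  have hn := congrArg (fun z : ℚ_[p] ↦ ‖z‖) h
  simp only [norm_mul, Padic.norm_p_zpow] at hn
  rw [show ‖((w : ℤ_[p]) : ℚ_[p])‖ = 1 from PadicInt.norm_units w,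
    show ‖((w' : ℤ_[p]) : ℚ_[p])‖ = 1 from PadicInt.norm_units w', mul_one, mul_one] at hn
  have hjj : j = j' := by
    have hp1 : (1 : ℝ) < p := by exact_mod_cast hp.out.one_lt
    have := zpow_right_injective₀ (by linarith) hp1.ne' hn
    linarith
  subst hjj
  refine ⟨rfl, ?_⟩
  have hw := mul_left_cancel₀ (zpow_ne_zero j hp0) h
  exact Units.ext (Subtype.ext hw)

/-! ### The subgroup `T_m = ⟨p⟩ · {w : w^{p−1} ≡ 1 (mod p^{m+1})}` and its index -/

/-- **The subgroup `T_m` of `ℚ_pˣ` (odd `p`) and its index `≤ p^m`.** There is a subgroup of `ℚ_pˣ` whose elements are exactly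
the `p^j · w`, `j ∈ ℤ`, `w ∈ ℤ_pˣ` with `w^{p−1} ≡ 1 (mod p^{m+1})` (i.e. `w ∈ μ_{p−1}·(1 + p^{m+1}ℤ_p)`), and its index is
at most `p^m`: it is the kernel of `ℚ_pˣ → ℤ_pˣ → (ℤ/p^{m+1})ˣ → (ℤ/p^{m+1})ˣ`, `x ↦ (unit part mod p^{m+1})^{p−1}`, whose image
is killed by `p^m` (the order of `(ℤ/p^{m+1})ˣ` is `(p−1)p^m`) and hence has at most `p^m` elements (`(ℤ/p^{m+1})ˣ` is CYCLIC for
odd `p`, Mathlib `ZMod.isCyclic_units_of_prime_pow`, and `IsCyclic.card_pow_eq_one_le`). It is the norm group of the `m`-th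
layer of the cyclotomic `ℤ_p`-tower of `ℚ_p` (part 5). [cite: NeukirchANT1999, Ch. II (5.7), Ch. V (1.1)]
[cite: Serre1973, Ch. II §3.2] -/
theorem exists_subgroup_oddLayerNorm (hp2 : p ≠ 2) (m : ℕ) :
    ∃ T : Subgroup ℚ_[p]ˣ,
      (∀ x : ℚ_[p]ˣ, x ∈ T ↔ ∃ (j : ℤ) (w : ℤ_[p]ˣ),
        toZModPow (m + 1) (((w : ℤ_[p])) ^ (p - 1)) = 1 ∧
          (x : ℚ_[p]) = (p : ℚ_[p]) ^ j * ((w : ℤ_[p]) : ℚ_[p])) ∧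
      T.index ≤ p ^ m := by
  have hp0 : (p : ℚ_[p]) ≠ 0 := by exact_mod_cast hp.out.ne_zero
  -- the unit-part homomorphism `ℚ_pˣ → ℤ_pˣ`
  have hdec : ∀ x : ℚ_[p]ˣ, ∃ (j : ℤ) (w : ℤ_[p]ˣ), (x : ℚ_[p]) = (p : ℚ_[p]) ^ j * ((w : ℤ_[p]) : ℚ_[p]) :=
    fun x ↦ exists_eq_prime_zpow_mul_units (x : ℚ_[p]) x.ne_zero
  choose jv wv hjw using hdec
  let υ : ℚ_[p]ˣ →* ℤ_[p]ˣ :=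
    { toFun := wv
      map_one' := by
        have h := hjw 1
        rw [Units.val_one, show (1 : ℚ_[p]) = (p : ℚ_[p]) ^ (0 : ℤ) * (((1 : ℤ_[p]ˣ) : ℤ_[p]) : ℚ_[p])
          by simp] at h
        exact (prime_zpow_mul_units_inj h).2.symm
      map_mul' := fun x y ↦ by
        have h := hjw (x * y)
        rw [Units.val_mul, hjw x, hjw y, show (p : ℚ_[p]) ^ jv x * ((wv x : ℤ_[p]) : ℚ_[p]) *
            ((p : ℚ_[p]) ^ jv y * ((wv y : ℤ_[p]) : ℚ_[p])) =
            (p : ℚ_[p]) ^ (jv x + jv y) * (((wv x * wv y : ℤ_[p]ˣ) : ℤ_[p]) : ℚ_[p]) by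
          rw [zpow_add₀ hp0]; push_cast; ring] at h
        exact (prime_zpow_mul_units_inj h).2.symm }
  have hυ : ∀ (x : ℚ_[p]ˣ) (j : ℤ) (w : ℤ_[p]ˣ),
      (x : ℚ_[p]) = (p : ℚ_[p]) ^ j * ((w : ℤ_[p]) : ℚ_[p]) → υ x = w := by
    intro x j w h
    rw [hjw x] at h
    exact (prime_zpow_mul_units_inj h).2
  -- reduction modulo `p^{m+1}` followed by the `(p−1)`-th power
  let ρ : ℤ_[p]ˣ →* (ZMod (p ^ (m + 1)))ˣ := Units.map (toZModPow (p := p) (m + 1)).toMonoidHom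
  let π : (ZMod (p ^ (m + 1)))ˣ →* (ZMod (p ^ (m + 1)))ˣ := powMonoidHom (p - 1)
  let ψ : ℚ_[p]ˣ →* (ZMod (p ^ (m + 1)))ˣ := π.comp (ρ.comp υ)
  refine ⟨ψ.ker, fun x ↦ ?_, ?_⟩
  · -- membership
    rw [MonoidHom.mem_ker]
    change (ρ (υ x)) ^ (p - 1) = 1 ↔ _
    have hρ : ∀ w : ℤ_[p]ˣ, (((ρ w) ^ (p - 1) : (ZMod (p ^ (m + 1)))ˣ) : ZMod (p ^ (m + 1))) =
        toZModPow (m + 1) (((w : ℤ_[p])) ^ (p - 1)) := fun w ↦ by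
      rw [Units.val_pow_eq_pow_val, map_pow]; rfl
    constructor
    · intro h
      refine ⟨jv x, υ x, ?_, hjw x⟩
      rw [← hρ, h, Units.val_one]
    · rintro ⟨j, w, hw, hx⟩
      rw [hυ x j w hx]
      exact Units.ext (by rw [hρ, hw, Units.val_one])
  · -- index `≤ p^m`: the image of `ψ` is killed by `p^m`, and `#{a : a^{p^m} = 1} ≤ p^m` in the cyclic group `(ℤ/p^{m+1})ˣ`
    haveI : NeZero (p ^ (m + 1)) := ⟨pow_ne_zero _ hp.out.ne_zero⟩
    haveI hcyc : IsCyclic (ZMod (p ^ (m + 1)))ˣ := ZMod.isCyclic_units_of_prime_pow p hp.out hp2 (m + 1)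
    have hcardG : Fintype.card (ZMod (p ^ (m + 1)))ˣ = (p - 1) * p ^ m := by
      rw [ZMod.card_units_eq_totient, Nat.totient_prime_pow hp.out (by omega), Nat.add_sub_cancel, mul_comm]
    -- every element of the range is killed by `p^m`
    have hkill : ∀ c ∈ ψ.range, c ^ p ^ m = 1 := by
      rintro c ⟨x, rfl⟩
      change ((ρ (υ x)) ^ (p - 1)) ^ p ^ m = 1
      rw [← pow_mul, ← hcardG, pow_card_eq_one]
    have hsub : (ψ.range : Set (ZMod (p ^ (m + 1)))ˣ) ⊆
        ↑(Finset.univ.filter (fun a : (ZMod (p ^ (m + 1)))ˣ ↦ a ^ p ^ m = 1)) := by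
      intro c hc
      simp only [Finset.coe_filter, Finset.mem_univ, true_and, Set.mem_setOf_eq]
      exact hkill c hc
    have hle : Nat.card ψ.range ≤ p ^ m := by
      have h1 : Nat.card ψ.range ≤ Nat.card (↑(Finset.univ.filter (fun a : (ZMod (p ^ (m + 1)))ˣ ↦ a ^ p ^ m = 1)) :
          Set (ZMod (p ^ (m + 1)))ˣ) := Nat.card_mono (Set.toFinite _) hsub
      rw [Nat.card_coe_set_eq, Set.ncard_coe_finset] at h1
      exact h1.trans (IsCyclic.card_pow_eq_one_le (pow_pos hp.out.pos m))
    rw [Subgroup.index_ker]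
    exact hle

end Summit.BirchSwinnertonDyer.BirchSwinnertonDyer.Theorems.MultTowerSplitExact

end
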